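import Summits.QuantumFields.BalabanUV.T4Continuum.Support.NE7EnergyGradRateWSU2
import Summits.QuantumFields.BalabanUV.T4Continuum.Support.NE7EnergyRateWSU2End
import HarnessLib

/-!
# NE7EnergyGradRateWSU2End — supplier stub (S-g′) of the NE7 crux, part 6 (ROAD-G108 §3): T-E_w♯ + (Gᶜ_w) IN THE CURRENCY OF ROUTE 1's END (`Regular … ε g`, the small data) —
# for SU(2), d = 4, L = 2, `0 < ε ≤ ε₀` and every period `N` there is `δ_V > 0` such that for every `0 < g`, flux-gradient letter `0 ≤ c` and `θ^{18} = 2⁻¹` there are `C, Λ_G ≥ 0`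
# with: for every data class `dom` inside the small data of radius `δ_V`, EVERY minimiser pair `U_A` (level `k ≥ 1`), `U_B` (level `k+1`, `Regular ε g`) whose flux gradients obey
# `‖∇_U F‖ ≤ c·(spacing)³` ((10) TYPE) admits `u, Z` with `U_A^{u} = (cavg U_B)e^{Z}`, `‖Z‖_w ≤ C·residualScale 4 2 N ε g k` AND `‖∇_W Z‖ ≤ Λ_G·θ^{38k}` — the socket `h_EG` of
# `NE7Route1EndDockedSmallDataSU2EG` for every pair the END reads, MODULO (10) TYPE

Cell `pub-balaban`, rung (B)+1 sub-cell t4, lineage `b2b-balaban-t4-ne7-p1`, generation 108 (CRUX PROVER NE7 #1 = OWNER of BINDER row NE7).  Memo `t4/b2b-balaban-t4-ne7-p1-g108/ROAD-G108.md` §3.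
WHY.  `NE7EnergyGradRateWSU2.ne3EnergyGradRateWSup_SU2` (this generation) asks the regularity radius `b` of the finer minimiser to satisfy `b + 10⁸b² ≤ ε`; the END reads minimiser pairs with
`Regular 4 L N ε g (k+1) U_B` (`b = ε`).  Exactly as gen 105's `NE7EnergyRateWSU2End`: over the small data EVERY minimiser of the `ε`-class is `SmallField ((ε∕4)∕M²)`
(`NE7AllMinimisersSmallSU2.all_minimisers_small_SU2`), so it is `Regular 4 2 N (ε∕4) g`, the theorem applies with `b = ε∕4`, and `residualScale` is monotone in `b`
(`NE7EnergyRateWSU2End.residualScale_mono_b`).  The order of binders is the END's: `δ_V` depends on `(ε, N)` only; `C, Λ_G` may depend on everything bound before the socket.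
WHAT ([folklore]; 0 def, 0 sorry).  **`ne3EnergyGradRateWSup_SU2_smallData`** (statement in the header).
HONEST FRAMING (page 1): composition of this generation's theorem with gen 105's (8)∀; the flux-gradient letters are HYPOTHESES of the TYPE of [Balaban1985Variational] Thm 1 (10) (asserted
for no minimiser — NOT a theorem of the tree); nothing of Bałaban's asserted as an axiom; NOT NE3∕NE7 as spine nodes; spine count = dagwriter∕referees' call; SU(2), `L = 2`, finite
4-torus, constants existential; NOT infinite volume, NOT mass gap, NOT BetaPertH, NOT Clay (continuum YM on T⁴ ⇐ BetaPertH ∧ nine spine estimates).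
-/

set_option autoImplicit false

open scoped BigOperators Matrix Matrix.Norms.L2Operator
open NormedSpace Finset Set

namespace Summit.QuantumFields.BalabanUV.T4Continuum.NE7EnergyGradRateWSU2End

open Literature.MathematicalPhysics.QuantumFieldTheory.Balaban1983to89
open B7Prop1Explicit B7Prop2Explicit
open T4AveragingDeficitWall (IsUnitaryCfg IsSkewDir SmallField vary Ad covGrad flux)
open T4AveragingDeficitWallBoundary (IsPeriodicCfg periodBox)
open AveragingDeficitPeriodicCounting (IsPeriodicDir)
open MinimalActionSandwich (IsMinimiser)
open MinimalActionRate (sfClass Regular)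
open NE3EnergyShapes (IsUnitarySite IsPeriodicSite residualScale residualScale_nonneg)
open NE3EnergyWeightedShapes (energyNormW energyNormW_nonneg)
open NE7EnergyGradRateWSU2 (ne3EnergyGradRateWSup_SU2)
open NE7EnergyRateWSU2End (residualScale_mono_b)
open NE7AllMinimisersSmallSU2 (all_minimisers_small_SU2)

noncomputable section

variable {n : Type} [Fintype n] [DecidableEq n]

/-- **T-E_w♯ + (Gᶜ_w) IN THE END's CURRENCY, MODULO (10) TYPE** (statement in the file header). [folklore] -/
theorem ne3EnergyGradRateWSup_SU2_smallData [Nonempty n] (hn : Fintype.card n = 2) :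
    ∃ ε₀ : ℝ, 0 < ε₀ ∧ ∀ ε : ℝ, 0 < ε → ε ≤ ε₀ → ∀ (N : ℕ) [NeZero N], 1 ≤ N → ∃ δV : ℝ, 0 < δV ∧
      ∀ g c : ℝ, 0 < g → 0 ≤ c → ∀ θ : ℝ, 0 < θ → θ ^ 18 = (((2 : ℕ) : ℝ))⁻¹ →
      ∃ C ΛG : ℝ, 0 ≤ C ∧ 0 ≤ ΛG ∧
        ∀ dom : Set (Site 4 → Fin 4 → (Matrix n n ℂ)ˣ),
          dom ⊆ {V : Site 4 → Fin 4 → (Matrix n n ℂ)ˣ | IsUnitaryCfg V ∧ IsPeriodicCfg V (N : ℤ) ∧ SmallField V δV} →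
          ∀ k : ℕ, 1 ≤ k → ∀ V ∈ dom, ∀ UA UB : Site 4 → Fin 4 → (Matrix n n ℂ)ˣ,
            IsMinimiser 4 (sfClass 4 2 N ε) 2 N k V UA → IsMinimiser 4 (sfClass 4 2 N ε) 2 N (k + 1) V UB → Regular 4 2 N ε g (k + 1) UB →
            (∀ (x : Site 4) (κ : Fin 4) (π : T4AveragingDeficitWall.Plane 4), ‖covGrad UA (flux UA) x κ π‖ ≤ c / (((2 : ℕ) : ℝ) ^ k) ^ 3) →
            (∀ (x : Site 4) (κ : Fin 4) (π : T4AveragingDeficitWall.Plane 4), ‖covGrad UB (flux UB) x κ π‖ ≤ c / (((2 : ℕ) : ℝ) ^ (k + 1)) ^ 3) →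
            ∃ (u : Site 4 → (Matrix n n ℂ)ˣ) (Z : Site 4 → Fin 4 → Matrix n n ℂ),
              IsUnitarySite u ∧ IsPeriodicSite u ((N * 2 ^ k : ℕ) : ℤ) ∧
              IsSkewDir Z ∧ IsPeriodicDir Z ((N * 2 ^ k : ℕ) : ℤ) ∧
              gaugeAct u UA = vary (rescale 2 (bavg 2 UB)) Z 1 ∧
              energyNormW 2 k (rescale 2 (bavg 2 UB)) Z (periodBox (N * 2 ^ k)) ≤ C * residualScale 4 2 N ε g k ∧
              (∀ (κ : Fin 4) (x : Site 4) (μ : Fin 4),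
                ‖Ad (rescale 2 (bavg 2 UB) (x + e κ) μ) (Z (x + e μ) κ) - Z x κ‖ ≤ ΛG * θ ^ (38 * k)) := by
  obtain ⟨ε₁, hε₁, H1⟩ := ne3EnergyGradRateWSup_SU2 (n := n) hn
  obtain ⟨ε₂, hε₂, H2⟩ := all_minimisers_small_SU2 (n := n) hn
  refine ⟨min ε₁ (min ε₂ (1 / 10 ^ 8)), lt_min hε₁ (lt_min hε₂ (by norm_num)), ?_⟩
  intro ε hε hεle N _ hN
  have hεε₁ : ε ≤ ε₁ := hεle.trans (min_le_left _ _)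
  have hεε₂ : ε ≤ ε₂ := hεle.trans ((min_le_right _ _).trans (min_le_left _ _))
  have hε8 : ε ≤ 1 / 10 ^ 8 := hεle.trans ((min_le_right _ _).trans (min_le_right _ _))
  obtain ⟨δV, hδV, Hsmall⟩ := H2 ε hε hεε₂ N hN
  refine ⟨δV, hδV, ?_⟩
  intro g c hg hc θ hθ hθ18
  -- the theorem at `b = ε/4`: the line `ε/4 + 10⁸(ε/4)² ≤ ε`
  have hb : (0 : ℝ) ≤ ε / 4 := by positivity
  have hbq : ε / 4 + 10 ^ 8 * (ε / 4) ^ 2 ≤ ε := by nlinarith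
  obtain ⟨C, s, hC, -, HC⟩ := H1 ε hε hεε₁ (ε / 4) g c hb hbq hg hc θ hθ hθ18
  obtain ⟨ΛG, hΛG, HN⟩ := HC N
  refine ⟨C, ΛG, hC, hΛG, fun dom hdom => ?_⟩
  intro k hk V hV UA UB hA hB hreg hgA hgB
  -- every minimiser of the `ε`-class is `SmallField ((ε/4)/M²)`: `U_B` is `Regular (ε/4) g`
  have hsmallB := Hsmall V (hdom hV) (k + 1) UB hB
  have hreg' : Regular 4 2 N (ε / 4) g (k + 1) UB := ⟨hreg.unitary, hreg.periodic, hsmallB, hreg.grad⟩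
  obtain ⟨u, Z, hu, huP, hZs, hZP, hgauge, hE, -, hG⟩ := HN dom k hk V hV UA UB hA hB hreg' hgA hgB
  refine ⟨u, Z, hu, huP, hZs, hZP, hgauge, hE.trans (mul_le_mul_of_nonneg_left ?_ hC), hG⟩
  exact residualScale_mono_b 4 2 N k hb (by linarith)

end

end Summit.QuantumFields.BalabanUV.T4Continuum.NE7EnergyGradRateWSU2End
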